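import Mathlib
import HarnessLib
import HarnessLib.Audit
import Summits.KontsevichZagierPeriods.Statement
import Literature.NumberTheory.Transcendental.KZProduct

/-!
Route: AmoebaArea

CLOSED (retired) 2026-08-16T03:23:11Z by planner-rchoice-KontsevichZagierPeriods-Amoeba-3c4bf1d0-0 — reason: route-choice:target-unreachable — target AmoebaKernel ⇔ summit modulo the engine (kernel-checked); no honest glue Crux… → AmoebaKernel inside the amoeba thesis — note: ROUTE-CHOICE (hold route.target-unreachable, operator 2026-08-16T02:57Z; options: glue Crux… → AmoebaKernel | retire) ⇒ RETIRED. WHY NO GLUE: the target AmoebaKernel is the kernel conjecture of KZ relativised to subgroups R ≥ relations containing the three engine relator families. Kernel-checked (ev. The file is kept as the record of this route; refuted decls are indexed as negative knowledge (`ledger negatives`).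

# Route AmoebaArea — amoeba areas are move chains — Cauchy–Riemann as the Jacobian identity, modulus
and phase as rule 2, the Newton polygon as the phase image

X = MaximalAreaLaw ∧ AmoebaKernel ("it suffices to show X"). Card realised:
amoeba-area-cauchy-riemann-is-a-move.
THE AMOEBA SECTOR. For f ∈ ℚ[z,w] with curve A = {f = 0} ⊂ (ℂˣ)², the exponentiated amoeba S_f =
{(x,y) ∈ ℝ²_{>0} : ∃ (z,w) ∈ A, |z| = x, |w| = y}
is ℚ-semialgebraic (Tarski–Seidenberg) and Area(Log A) = ∫_{S_f} dx dy/(xy): a 2-dimensional KZ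
representation with RATIONAL integrand. The
Passare–Rullgård / Mikhalkin–Rullgård theorems (PassareRullgard2004; MikhalkinRullgard2001 Thm 1:
Area(Δ) > 0 ⇒ [Area = π²·Area(Δ) ⇔ Log|_A at
most 2-to-1 and A real up to a constant ⇔ ℝA is a possibly singular Harnack curve]) thus become a
family of Conjecture-1 instances
2·[S_f, 1/(xy)] ~ (2·Area Δ)·[π]⋆[π] over the whole Harnack locus — a positive-dimensional
semialgebraic family of rational representations
on which the value is CONSTANT, certified pointwise (no Picard–Fuchs equation). MaximalAreaLaw
(ENGINE, rank 2) is M–R's implication (2 ⇒ 1)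
as a CHAIN for every squarefree f over ℚ; DiamondHarnack (rank 3: k + z + 1/z + w + 1/w, k ≥ 4,
genus one, value 2π²) and SquareHarnack
(rank 4: a + bz + cw + dzw, abcd < 0, value π²) are its typed staffable families; LineAmoeba
(2·[{|x−y| < 1 < x+y}, 1/(xy)] ~ [π]⋆[π], a
triangle-inequality representation of π²/2 = 3ζ(2)) and the three one-move charts of its two
competing chains are support. AmoebaKernel
(TARGET, GPC-strength, stated openly) is the kernel conjecture of the calculus enlarged by these
relators ("freshman calculus with the
maximal-area law as a rule"); modulo the engine it is equivalent to
Literature.NumberTheory.Transcendental.KZKernelConjecture.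
Lean: `MaximalAreaLaw ∧ AmoebaKernel`

## Assembly
Pure algebra, PROVED as an `example` in the planner's Sketch.lean (rc 0, 4 lines): given
MaximalAreaLaw, DiamondHarnack, SquareHarnack and
AmoebaKernel, instantiate the kernel statement at R := KZ.relations (le_rfl; the three engine
hypotheses are literally the three cruxes) to get
ker KZ.eval ≤ KZ.relations, i.e. Literature.NumberTheory.Transcendental.KZKernelConjecture, and
conclude by
Summit.KontsevichZagierPeriods.KernelForm.kontsevichZagierPeriods_of_kzKernelConjecture
(Theorems/KernelFormKernelImpliesStatement.lean).
A prover can copy the proof verbatim. The four support items are not in the implication chain: they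
are the calibration (LineAmoeba = the
law at N = 1) and the first moves of its two chains.

Rationale: WHY THIS LINE. The classical proof is already a move chain once read pointwise (PassareRullgard2004
Lemmas 1–2 as recapitulated in MikhalkinRullgard2001 §3–4):
(M1) on A the holomorphic 2-form d log z ∧ d log w vanishes, so Log*(du∧dv) = Arg*(dθ∧dφ) EXACTLY —
in a ℚ-semialgebraic chart (s,t) of a cell
of A(ℂ) ⊂ ℝ⁴ this is a pointwise identity |J_Log|/(xy) = |J_Arg| between two semialgebraic Jacobians
(M–R: "det M_j = 1"), i.e. no move at all;
(M2) modulus (z,w) ↦ (|z|,|w|) and phase (z,w) ↦ (tan(arg z/2), tan(arg w/2)) are ℚ-semialgebraic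
maps, injective on the half-curve C⁺ of a
Harnack curve (the 2-to-1 hypothesis), so each is ONE instance of rule 2 — no logarithm or
arctangent is ever applied, which is how the line
stays outside Literature.Barriers.KontsevichZagierPeriods.noSemialgebraicPrimitive_inv_sub_two; (M3)
the gradient of the Ronkin function is
the lifted phase map, ∇N_f = const + (arg w, −arg z)/π on the amoeba, and ∇N_f(A) = Δ° minus lattice
points (PaRu Lemma 1; checked by hand on
the line: (θ′/π, 1 − θ/π) fills the standard triangle), so the phase image of C⁺ is π·Δ° read period
by period, and a unimodular
triangulation of Δ plus SL₂(ℤ) shears (rational in the tangent half-angle charts, the torus shear of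
route KinematicFormulas) reduces it to
2·Area(Δ) copies of the standard triangle {0 < θ′ < θ < π}, whose chart representation [{0 < q < p},
4/((1+p²)(1+q²))] doubles to [π]⋆[π].
Imported area: amoebas and tropical/real algebraic geometry (ForsbergPassareTsikh2000,
Mikhalkin2000, MikhalkinRullgard2001, PassareRullgard2004),
dimers (KenyonOkounkovSheffield2006, KenyonOkounkov2006: Harnack curves = dimer spectral curves;
SquareHarnack at (1,1,1,−1) and DiamondHarnack at
k = 4 are the square-lattice spectral curves) and coamoebas (Johansson2013: shell = geodesic
arrangement dual to the edges of Δ). What no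
prior route does: MarkovTreeOfMoves uses amoeba COMPLEMENTS as torus radii for Laurent periods;
GaussManinCertificates certifies constant
families by flat sections; K2SymbolChains treats the VALUE N_f(0) = m(f) (Mahler measure: m(1+z+w) =
L′(χ₋₃,−1), Smyth1981; m(k+z+1/z+w+1/w)
↔ L′(E,0), Boyd1998, Deninger1997) which needs a K₂ witness — this line does the CURVATURE MASS of
the same Ronkin function, accessible in
three move types; the negatives index is empty.

RANKED CRUXES. #0 AmoebaKernel (target) — kernel conjecture of the enlarged calculus KZ^amoeba:
every subgroup R ≥ KZ.relations of the formal group that contains the maximal-area relators 2·[S_f,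
1/(xy)] − N·[π]⋆[π] (f squarefree over ℚ, Log at most 2-to-1 on A, N = 2·Area(Δ_f)), the diamond
relators [S_k] − 2·[π]⋆[π] (k ≥ 4) and the square relators [S_(a,b,c,d)] − [π]⋆[π] (abcd < 0)
contains ker KZ.eval. Honest status: KZKernelConjecture ⇒ it (example in Sketch.lean); it ∧ engine ⇒
KZKernelConjecture (R := relations) — GPC-strength, filed so that the engine is load-bearing in the
Assembly and KZ^amoeba is on record as a formal object. (why it might fail: GPC-strength (the
strength barriers bite here and only here): false iff some equal-valued pair stays underivable even
with the amoeba relators adjoined — they are value identities of Harnack curves and do not touch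
route Neg's pressure points (regularised MZV relations, Γ-detours).) [KontsevichZagier2001,
HuberMullerStach2017, MikhalkinRullgard2001]
#2 MaximalAreaLaw (crux) — THE ENGINE (card A2 in full generality; Mikhalkin–Rullgård Thm 1,
implication (2) ⇒ (1), as a chain). For every squarefree f ∈ ℚ[z,w] and N ∈ ℕ with N =
2·Area(conv(supp f)) such that for all x, y > 0 the torus {|z| = x, |w| = y} meets {f = 0} in at
most two points, and every representation r with r.domain = S_f = {p ∈ ℝ²_(>0) : ∃ z w ∈ ℂ, |z| =
p₀, |w| = p₁, f(z,w) = 0} and integrand 1/(p₀p₁) on it: 2 • KZ.of r − N • KZ.of ([π]⋆[π]) ∈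
KZ.relations (values 2·Area(amoeba) = 2π²Area(Δ) = N·π², M–R Thm 1; N = 0 forces S_f null or the
hypothesis to fail; 'Squarefree' is needed — for f = g² condition (2) holds and (1) fails). Foreseen
chain: modulus chart C⁺ → S_f° (rule 2) · CR identity · phase chart on period cells (rule 2) landing
in π·Δ° · unimodular triangulation + SL₂(ℤ) shears · 2·[standard triangle] ~ [π]⋆[π]. [difficulty:
XL] (why it might fail: Uniformity over all Δ: one chain schema must certify, from the coefficients
alone, that the lifted phase map is injective on C⁺ with image π·Δ° (PaRu Lemma 1 is proved via
Monge–Ampère/Legendre duality, not constructively) and cut it into period cells semialgebraically;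
XL bookkeeping.) [MikhalkinRullgard2001, PassareRullgard2004, Mikhalkin2000, Johansson2013,
KontsevichZagier2001]
#3 DiamondHarnack (crux) — THE GENUS-ONE FAMILY (card A2/contrast family; Boyd's tempered family).
For every rational k ≥ 4 and every representation r with r.domain = S_k = {p ∈ ℝ²_(>0) : ∃ z w ∈ ℂ,
|z| = p₀, |w| = p₁, z²w + zw² + k·zw + z + w = 0} (i.e. k + z + 1/z + w + 1/w = 0 on the torus;
Newton polygon the diamond, area 2, one interior point) and integrand 1/(p₀p₁): KZ.of r − 2 • KZ.of
([π]⋆[π]) ∈ KZ.relations. Values: Area(amoeba) = 2π² = π²·Area(◇) on the Harnack locus |k| ≥ 4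
(numerics in the planner folder num/diamond_area.py, num/diamond_k4.py: 19.739196 at k = 4 against
2π² = 19.739209; 19.73923 / 19.73916 / 19.73887 at k = 4.5, 5, 6; continuous drop below: 19.736 at
3.999, 16.38 at 3, 0 at k = 0 where the curve is (z+w)(1+1/zw)); k = 4 is CERTIFIED ALGEBRAICALLY:
(1 + z + w − zw)(1 − z − w − zw) = 1 + z²w² − z² − w² − 4zw, so under the 2-to-1 monomial map (Z,W)
= (−zw, z/w) the union of the square-lattice dimer curve and its sign twist covers {Z + 1/Z + W +
1/W + 4 = 0}, whose amoeba is therefore the image of the square amoeba under (u,v) ↦ (u+v, u−v) (det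
2): area 2·π² exactly, with a real node at Z = W = −1 (singular Harnack = uniform square lattice
with doubled fundamental domain); k > 4 opens the oval (amoeba with a hole; 2×2-periodic weights).
Fibre formula used: meas Log-fibre over u = 2(arccosh(s₊/2) − arccosh(s₋/2)), s = (|E+k+2| +
|E+k−2|)/2, E = 2cosh u cos θ + 2i sinh u sin θ. The Mahler measure of the same polynomial is Boyd's
L′(E_k,0) family — inaccessible without a K₂ witness; its amoeba AREA is claimed accessible.
[difficulty: L] (why it might fail: k = 4 is certified (isogeny pullback of the square curve);
Harnack-ness for ALL rational k > 4 rests on numerics (5 digits at 4.5, 5, 6) plus dimer theory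
(2×2-periodic weights): if some k folds, the area drops below 2π² and ¬ follows by soundness. Chain
needs two w-sheets glued along a cut.) [MikhalkinRullgard2001, KenyonOkounkovSheffield2006,
Boyd1998, BoydRodriguezVillegas2002, KontsevichZagier2001]
#4 SquareHarnack (crux) — THE UNIT-SQUARE FAMILY = card A2 for Δ = □ in full (Harnack locus = the
semialgebraic cell abcd < 0 of coefficient space). For all rationals a, b, c, d with abcd < 0 and
every representation r with r.domain = {p ∈ ℝ²_(>0) : ∃ z w ∈ ℂ, |z| = p₀, |w| = p₁, a + bz + cw +
dzw = 0} and integrand 1/(p₀p₁): KZ.of r − KZ.of ([π]⋆[π]) ∈ KZ.relations. Values: torus dilation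
normalises to 1 + z + w + t·zw, t = ad/(bc) < 0; the Log-fibre over |z| = x is the full interval
[||a|−|b|x||/(|c|+|d|x), (|a|+|b|x)/||c|−|d|x||] (the ratio |a+bz|/|c+dz| is monotone in cos θ
exactly when abcd < 0, which is also the 2-to-1 property), so Area = L(|b/a|) + L(|d/c|) = π² with
L(α) = ∫₀^∞ log((1+αx)/|1−αx|) dx/x = π²/2 for every α > 0; numerics 9.8704 (t = −1), 9.8702 (t =
−1/2), 9.8673 (t = −3, grid-limited) against π² = 9.8696, and the drop outside the locus: 3.8214 at
t = 1/2 and t = 2, 0 at t = 1 where (1+z)(1+w) is reducible. (a,b,c,d) = (1,1,1,−1) is the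
square-lattice dimer spectral curve. [difficulty: M] (why it might fail: Values certified (π² on the
whole cell); the risk is the UNIFORM chain: the singular fibres x = |a/b|, |c/d| and the phase image
(a π×π square cut by period lines into pieces that move with arg-data of a,b,c,d) must be carried
semialgebraically in the parameters; false as typed only by a slip.) [MikhalkinRullgard2001,
ForsbergPassareTsikh2000, KenyonOkounkovSheffield2006, KontsevichZagier2001]
#9 LineAmoeba (support) — CALIBRATION (card A1; the law with N = 1). For every representation r with
r.domain = {p : 0 < p₀, 0 < p₁, 1 < p₀ + p₁, p₀ < p₁ + 1, p₁ < p₀ + 1} (the open exponentiated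
amoeba of 1 + z + w: the triangle inequalities for side lengths 1, x, y) and integrand 1/(p₀p₁): 2 •
KZ.of r − KZ.of ([π]⋆[π]) ∈ KZ.relations. Value ∫ dx dy/(xy) = ∫₀^∞ log((1+x)/|1−x|) dx/x = π²/2
(4.9348022 numerically, 7 digits) — a triangle-inequality representation of 3ζ(2) that is neither a
simplex nor a product. TWO explicit chains of about ten moves each: the Cauchy–Riemann chain
LineModulusChart⁻¹ · LinePhaseChart · swap symmetry (p,q) ↦ (q,p) · product [ℝ_(>0), 2/(1+p²)]^×2 ~
[π]⋆[π]; and the dilogarithm chain: split at x = 1, inversion (x,y) ↦ (1/x, y/x) (rule 2, |J| = x⁻³)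
onto the half x < 1, LineShearChart, u = 1 − 2s and 1/(1−xu) + 1/(1+xu) = 2/(1−x²u²) (rules 2, 1a,
1b), then Calabi's rational-trigonometric change of variables for ∫∫ dxdu/(1−x²u²) = π²/8
(Beukers–Kolk–Calabi) — the first explicit pair of structurally different chains for one identity
(datum for routes CommonUnfolding / proof-complexity cards). [difficulty: provable-now]
[PassareRullgard2004, ForsbergPassareTsikh2000, KontsevichZagier2001]
#9 LineModulusChart (support) — (M2, modulus; ONE rule-2 move.) The upper half plane H = {(s,t) : t
> 0} ≅ C⁺ = {(z, −1−z) : Im z > 0} parametrises half the line; Φ(s,t) = (|z|, |1+z|) = (√(s²+t²),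
√((1+s)²+t²)) is ℚ-semialgebraic, injective on H, Φ(H) = the open triangle-inequality region, |det
Φ′| = t/(xy); hence for r = [H, t/((s²+t²)((1+s)²+t²))] and r′ = [Φ(H), 1/(xy)]: KZ.of r − KZ.of r′
∈ KZ.relations (one element of changeOfVariablesRel). Values both π²/2 (the s-fibre integral is
exactly 2π/(1+4t²)). [difficulty: provable-now] [MikhalkinRullgard2001, KontsevichZagier2001,
BCR1998]
#9 LinePhaseChart (support) — (M1+M2, phase; ONE rule-2 move with Cauchy–Riemann inside the
Jacobian.) Ψ(s,t) = (tan(arg z/2), tan(arg(1+z)/2)) = (t/(s + √(s²+t²)), t/(1 + s + √((1+s)²+t²)))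
is ℚ-semialgebraic and injective on H with image {0 < q < p} (0 < arg(1+z) < arg z < π) and |det Ψ′|
= (1+p²)(1+q²)/4 · t/(|z|²|1+z|²) — the factor t/(|z|²|1+z|²) = |J_Arg| equals |J_Log|/(xy)
pointwise (CR); hence for r = [H, t/((s²+t²)((1+s)²+t²))] and r′ = [{0 < q < p}, 4/((1+p²)(1+q²))]:
KZ.of r − KZ.of r′ ∈ KZ.relations. Values both π²/2 (∫₀^∞ 4 arctan p dp/(1+p²) = 2(π/2)²); {0 < q <
p} is the chart of the phase polygon π·Δ° of the line. [difficulty: provable-now]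
[MikhalkinRullgard2001, PassareRullgard2004, KontsevichZagier2001]
#9 LineShearChart (support) — (The competing dilogarithm chain's first move, recorded for the
two-chains comparison; refuter triage note of the card.) On the half x < 1 the Log-fibre is (1−x,
1+x); the shear y = 1 − x + 2xs (rule 2, |J| = 2x) gives, for r = [(0,1)², 2/(1 − x + 2xs)] and r′ =
[{0 < x < 1, 1−x < y < 1+x}, 1/(xy)]: KZ.of r − KZ.of r′ ∈ KZ.relations. Values both π²/4 (= 2·Σ
1/(2n+1)², Legendre χ₂(1)·2). [difficulty: provable-now] [KontsevichZagier2001, PassareRullgard2004]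

TWO-LAYER PLAN. Foreseen glued splits (k ≤ 3, depth 1), filed only after a crux closes or stalls
with a census: MaximalAreaLaw ⇐ PhaseImageIsPolygon (for
squarefree f with Log ≤ 2-to-1: the lifted phase map C⁺ → ℝ² is injective with image π·Δ° up to null
sets — PaRu Lemma 1 + M–R §4.2 made
semialgebraic) → TriangulatedPolygonRep (a period-cell decomposition of a lattice polygon's angular
representation ~ 2·Area(Δ) standard
triangles, by SL₂(ℤ) shears in half-angle charts) → MaximalAreaLaw; DiamondHarnack ⇐ DiamondSheets
(the two w-sheets of z²w + zw² + kzw + z + w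
over the z-plane as semialgebraic charts, modulus move) → DiamondPhase (phase image = π·◇° in two
period cells) → DiamondHarnack, with the
special fibre k = 4 available at once from SquareHarnack at (1,1,1,−1): the monomial map (x,y) ↦
(xy, x/y) is ONE rule-2 move
[S_□, 2/(xy)] ~ [S_4, 1/(XY)] (|det| = 2x/y), then integrand additivity;
SquareHarnack ⇐ normalisation by torus dilation (one rule-2 move with rational factors |a/b|, |a/c|)
→ the t-family 1 + z + w + t·zw → SquareHarnack.

KILL CRITERIA. Every typed engine item is an accessibility statement whose two sides are CERTIFIED
equal (M–R Thm 1; the explicit integrals above): a genuine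
non-derivability proof for any of them refutes the SUMMIT — report to the operator, close
`refuted:<Decl>` and hand the witness to route Neg.
A refutation 'as typed' (DiamondHarnack: some rational k ≥ 4 turns out non-Harnack, the area drops
and ¬ follows from soundness; or a slip in a
domain description) forces a 1:1 `--restate` (e.g. 4 < k, or |k| ≥ k₀), not a pivot. The line's BET
dies if MaximalAreaLaw is shown to need a
non-semialgebraic stratification of the Harnack locus (it should not: 'Log ≤ 2-to-1' is first-order)
— then restate per Newton polygon.
KZKernelConjecture settled elsewhere (either way) moots the target; a proof of LineAmoeba by the
dilogarithm chain alone does not hurt the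
route (any proof closes an item) but leaves the CR content to LineModulusChart/LinePhaseChart.

NOT DECOMPOSED YET. The coamoeba side as a statement of its own (Σ mult × cell areas): the unsigned
count ∫_T² #Arg⁻¹ is NOT a function of Δ off the Harnack locus
(planner numerics: 7.6407 for 1 + z + w + zw/2 against 2π² on the locus; Johansson2013: only the
SIGNED index has mean zero), so no general
coamoeba-degree item is filed — the phase polygon enters only through MaximalAreaLaw's chain; higher
Harnack families (degree-d plane curves,
area π²d²/2; genus ≥ 2 dimer curves) — instances of the law, filed per family only if DiamondHarnack
lands; the Passare–Rullgård INEQUALITY off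
the locus (inequalities are not statements of the calculus); n ≥ 3 (amoebas of hypersurfaces have
infinite volume; Monge–Ampère masses of
faces would be the analogue); the standard-triangle lemma 2·[{0<q<p}, 4/((1+p²)(1+q²))] ~ [π]⋆[π]
and [ℝ_(>0), 2/(1+p²)] ~ [π] (prover
lemmas via --supports, shared with KinematicFormulas/CompiledSubstitutions).

CHEAPEST FALSIFIER. Value audits, cheapest first (all run here, pure-python quadrature in the
planner folder num/): (i) LineAmoeba 4.9348022 vs π²/2 (7 digits) and
the two chart representations (exact: inner integrals 2π/(1+4t²) and 4 arctan p/(1+p²)); (ii)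
SquareHarnack: π² at t = −1, −1/2, −3 and the drop
3.82 at t = 1/2, 2; (iii) DiamondHarnack: 2π² at k = 4 (6 digits), 4.5, 5, 6 and the continuous drop
below 4 — a refuter should re-derive the
fibre formula 2(arccosh(s₊/2) − arccosh(s₋/2)) from the typed set and push k = 4 and large k (k =
50) to 8 digits; (iv) the lookup that would
kill the NOVELTY: a rules/period-calculus reading of Passare–Rullgård in print (zbMATH 'amoeba area
dilogarithm' = 0, 'amoeba area period
motive' = 0 per the card; nothing in lit frontier since 2020); (v) the typed law at N = 0 and at
reducible/non-reduced f (checked above: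
vacuous resp. excluded by Squarefree).

NUMBERS. Area(amoeba) ≤ π²·Area(Δ) (PassareRullgard2004), equality iff Harnack
(MikhalkinRullgard2001 Thm 1); line: π²/2 = 4.934802; unit square: π²;
diamond: 2π² = 19.739209; coamoeba of the line: two triangles of total angular area π² =
2·Area(amoeba); Ronkin gradient of the line on the
amoeba: (θ′/π, 1 − θ/π) ∈ Δ°; Mahler measures of the same polynomials (the inaccessible contrast):
m(1+z+w) = (3√3/4π)L(χ₋₃,2) = 0.3230659
(Smyth1981), m(k + z + 1/z + w + 1/w) ∈ ℚ·L′(E_k,0) conjecturally/proved for finitely many k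
(Boyd1998, Deninger1997). Items at open: 9
(1 target, 1 assembly, 3 cruxes, 4 support); no informal items; no definition requests.

DEFINITION REQUESTS. None needed to type the items (MvPolynomial, convexHull, volume, Set.encard,
Complex norms and KZ.piRep.prod exist). Optional later (tenure):
notion SimpleHarnackCurve (Mikhalkin2000 / MikhalkinRullgard2001 Def. 2–3) in
Literature/AlgebraicGeometry, to restate MaximalAreaLaw with
condition (3) instead of (2) and to vendor M–R Thm 1 and PaRu Lemma 1 as named facts (values side).

Novelty: Searches (2026-08-15): hub: grep of all 57 Theses files of the sub-problem for
amoeba|coamoeba|Ronkin|Harnack|Passare (1 hit: MarkovTreeOfMoves,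
'amoeba complement' as torus radii — different mechanism), the 31 Ideas files (only this card),
`ledger negatives` (0); `lit read
arxiv:math/0010087` (MikhalkinRullgard2001 READ pp. 1–7: Thm 1, Def. 2–3, Lemmas 1–6, §4.2); `lit
galaxy search "coamoeba" --star all` (10 rows:
Johansson's thesis pdf:4326326760 READ §4 (shell, argument cycle, index map of mean zero, Thm
4.4/4.8), Passare–Pochekutov–Tsikh 2012 amoebas in
thermodynamics, tropical software; nothing on periods), `lit galaxy search "amoeba of maximal area"
| "Harnack curve amoeba" --star all` (0),
`lit search` / `lit search --hybrid` (searchd rc 75 all session — recorded in NOTES), the card's own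
zbMATH/crossref queries ('amoeba area
dilogarithm' = 0, 'amoeba area period motive' = 0) and `lit frontier KontsevichZagierPeriods --since
2021` (no amoeba papers cite the KZ roots).
Nearest prior art found: MikhalkinRullgard2001 (doi:10.1155/s107379280100023x) Thm 1 and
PassareRullgard2004 (doi:10.1215/s0012-7094-04-12134-7)
Lemmas 1–2 — the theorems and, implicitly, the pointwise CR computation; KenyonOkounkovSheffield2006
/ KenyonOkounkov2006 (Harnack locus, Ronkin =
free energy); Johansson2013 (coamoeba shell); Boyd1998 / Smyth1981 (the Mahler-measure contrast);
hub card k2-steinberg-calculus-mahler-boyd (Ronkin VALUE).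
Delta: the maximal-area theorem typed as a uniform family of  [refs: 10.1155/s107379280100023x, 10.1215/s0012-7094-04-12134-7, math/0010087, arxiv:math/0010087, doi:10.1155/s107379280100023x, doi:10.1215/s0012-7094-04-12134-7, MikhalkinRullgard2001, PassareRullgard2004, KenyonOkounkovSheffield2006, KenyonOkounkov2006, Johansson2013, Boyd1998, Smyth1981]

Barriers (technique_class: compile, pointwise-jacobian-identity, arc-additivity): - technique_class: compile, pointwise-jacobian-identity, arc-additivity
- Literature.Barriers.KontsevichZagierPeriods.noSemialgebraicPrimitive_inv_sub_two: EVADED by design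
— no variable is ever integrated out in the CR chain (the Log-fibre integral ∫dy/(xy) = log-ratio
and the s-fibre integral 2π/(1+4t²) are exactly the forbidden primitives and are never taken); Log
and Arg are never applied, only |·| and tan(arg/2) = t/(s+|z|), which are semialgebraic rule-2 data;
the competing dilogarithm chain meets the barrier and evades it the usual way (shear to a rational
integrand, Calabi's rational-trigonometric substitution), never by a log primitive.
- Literature.Barriers.KontsevichZagierPeriods.cressonViuSos_prop_3_2: respected — every chain
dissects first (half-curves C⁺/C⁻, w-sheets of the diamond, period cells of the phase image,
unimodular triangles) and maps the pieces by injective semialgebraic charts; no global scissors-free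
map between S_f and a product of discs is claimed.
- Literature.Barriers.KontsevichZagierPeriods.kzConjecture_implies_oddZetaAlgIndep: bites ONLY the
target AmoebaKernel (GPC-strength, said openly); every crux/support item is an unconditional
accessibility statement between representations with certified equal values in ℚ·π², so no
independence statement is implied by any engine item.
- Literature.Barriers.KontsevichZagierPeriods.not_complete_of_undecidable: consistent — the engine
concerns an explicitly decidable family (values N·π²/2 with N read off

Novelty grade: new-combination — ROUTE REVIEW #2 rreview-0815T12-32-g2 (independent 2nd pass; review #1 rreview-0815T12-33's verdict/stamps/briefings STAND: 9/9 rc0, nothing trivial, value side = M–R Thm 1, DiamondHarnack Harnack ∀k≥4 proved (evidence 8502), novelty new-combination, barriers genuinely evaded, not a recombination of (refuter refuter-rreview-0815T12-32-g2-0, 2026-08-15T14:57:16Z; prior: doi:10.1155/s107379280100023x (MikhalkinRullgard2001 = arXiv:math/0010087; Thm 1, Lemmas 2-4 pp.5-6 read), doi:10.1215/s0012-7094-04-12134-7 (PassareRullgard2004), arXiv:math/0311062 (KenyonOkounkov2006), KenyonOkounkovSheffield2006, Mikhalkin2000 (simple Harnack curves), KontsevichZagier2001)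

History (route lifecycle, newest last):
- 2026-08-16T02:18:24Z · AUTO-CRUX: 1 conjecture-grade item(s) promoted to crux (AmoebaKernel) — refuter vetting / tiering apply (operator:999:1362873)
- 2026-08-16T03:23:12Z · CLOSED retired — route-choice:target-unreachable — target AmoebaKernel ⇔ summit modulo the engine (kernel-checked); no honest glue Crux… → AmoebaKernel inside the amoeba thesis (planner-rchoice-KontsevichZagierPeriods-Amoeba-3c4bf1d0-0)

sub-problem: KontsevichZagierPeriods · status: closed(retired) · opened planner-plancard-KontsevichZagierPeriods-Kont-29f86439-0 2026-08-15T12:55:30Z · rev 2 · ledger route-KontsevichZagierPeriods-AmoebaArea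
GENERATED by the gate from the ledger (D-0016/17). Provers cite these decls: `theorem foo : Summit.KontsevichZagierPeriods.KontsevichZagierPeriods.Theses.AmoebaArea.<Decl> := …` in Summits/KontsevichZagierPeriods/KontsevichZagierPeriods/Theorems/<Name>.lean.
-/

namespace Summit.KontsevichZagierPeriods.KontsevichZagierPeriods.Theses.AmoebaArea

open scoped BigOperators Topology Manifold Classical MeasureTheory ProbabilityTheory Matrix InnerProductSpace ComplexConjugate ContinuousMap
open Filter Set Function TopologicalSpace MeasureTheory

attribute [summit_statement] _root_.KontsevichZagierPeriods

open Literature Periods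

/-- item stmt-KontsevichZagierPeriods-8500 · target · rank 0 · closed · moot by None · by planner
why it might fail: GPC-strength (the strength barriers bite here and only here): false iff some equal-valued pair stays underivable even with the amoeba relators adjoined — they are value identities of Harnack curves and do not touch route Neg's pressure points (regularised MZV relations, Γ-detours).
sources: KontsevichZagier2001, HuberMullerStach2017, MikhalkinRullgard2001
[target] kernel conjecture of the enlarged calculus KZ^amoeba: every subgroup R ≥ KZ.relations of
the formal group that contains the maximal-area relators 2·[S_f, 1/(xy)] − N·[π]⋆[π] (f squarefree
over ℚ, Log at most 2-to-1 on A, N = 2·Area(Δ_f)), the diamond relators [S_k] − 2·[π]⋆[π] (k ≥ 4)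
and the square relators [S_(a,b,c,d)] − [π]⋆[π] (abcd < 0) contains ker KZ.eval. Honest status:
KZKernelConjecture ⇒ it (example in Sketch.lean); it ∧ engine ⇒ KZKernelConjecture (R := relations)
— GPC-strength, filed so that the engine is load-bearing in the Assembly and KZ^amoeba is on record
as a formal object. -/
@[route_item "route-KontsevichZagierPeriods-AmoebaArea"]
def AmoebaKernel : Prop :=
  ∀ R : AddSubgroup Literature.NumberTheory.Transcendental.KZ.FormalRep, Literature.NumberTheory.Transcendental.KZ.relations ≤ R → (∀ (f : MvPolynomial (Fin 2) ℚ) (N : ℕ), Squarefree f → (N : ℝ) = 2 * (MeasureTheory.volume (convexHull ℝ ((fun e : Fin 2 →₀ ℕ => fun i : Fin 2 => ((e i : ℕ) : ℝ)) '' (↑f.support : Set (Fin 2 →₀ ℕ))))).toReal → (∀ x y : ℝ, 0 < x → 0 < y → ({q : ℂ × ℂ | ‖q.1‖ = x ∧ ‖q.2‖ = y ∧ MvPolynomial.aeval ![q.1, q.2] f = 0} : Set (ℂ × ℂ)).encard ≤ 2) → ∀ (r : Literature.NumberTheory.Transcendental.KZ.IntegralRep 2), r.domain = {p : Fin 2 →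 ℝ | 0 < p 0 ∧ 0 < p 1 ∧ ∃ z w : ℂ, ‖z‖ = p 0 ∧ ‖w‖ = p 1 ∧ MvPolynomial.aeval ![z, w] f = 0} → Set.EqOn r.integrand (fun p => 1 / (p 0 * p 1)) r.domain → 2 • Literature.NumberTheory.Transcendental.KZ.of r - N • Literature.NumberTheory.Transcendental.KZ.of (Literature.NumberTheory.Transcendental.KZ.piRep.prod Literature.NumberTheory.Transcendental.KZ.piRep) ∈ R) → (∀ k : ℚ, 4 ≤ k → ∀ (r : Literature.NumberTheory.Transcendental.KZ.IntegralRep 2), r.domain = {p : Fin 2 → ℝ | 0 < p 0 ∧ 0 < p 1 ∧ ∃ z w : ℂ, ‖z‖ = p 0 ∧ ‖w‖ = p 1 ∧ z ^ 2 * w + z * w ^ 2 + (k : ℂ) * z * w + z + w = 0} → Set.EqOn r.integrand (fun p => 1 / (p 0 * p 1)) r.domain → Literature.NumberTheory.Transcendental.KZ.of r - 2 • Literature.NumberTheory.Transcendental.KZ.of (Literature.NumberTheory.Transcendental.KZ.piRep.prod Literature.NumberTheory.Transcendental.KZ.piRep) ∈ R) → (∀ a b c d : ℚ, a * b * c * d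 < 0 → ∀ (r : Literature.NumberTheory.Transcendental.KZ.IntegralRep 2), r.domain = {p : Fin 2 → ℝ | 0 < p 0 ∧ 0 < p 1 ∧ ∃ z w : ℂ, ‖z‖ = p 0 ∧ ‖w‖ = p 1 ∧ (a : ℂ) + (b : ℂ) * z + (c : ℂ) * w + (d : ℂ) * z * w = 0} → Set.EqOn r.integrand (fun p => 1 / (p 0 * p 1)) r.domain → Literature.NumberTheory.Transcendental.KZ.of r - Literature.NumberTheory.Transcendental.KZ.of (Literature.NumberTheory.Transcendental.KZ.piRep.prod Literature.NumberTheory.Transcendental.KZ.piRep) ∈ R) → ∀ c : Literature.NumberTheory.Transcendental.KZ.FormalRep, Literature.NumberTheory.Transcendental.KZ.eval c = 0 → c ∈ R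

/-- item stmt-KontsevichZagierPeriods-8501 · crux · rank 2 · closed · moot by None · by planner
why it might fail: Uniformity over all Δ: one chain schema must certify, from the coefficients alone, that the lifted phase map is injective on C⁺ with image π·Δ° (PaRu Lemma 1 is proved via Monge–Ampère/Legendre duality, not constructively) and cut it into period cells semialgebraically; XL bookkeeping.
sources: MikhalkinRullgard2001, PassareRullgard2004, Mikhalkin2000, Johansson2013, KontsevichZagier2001
[crux] THE ENGINE (card A2 in full generality; Mikhalkin–Rullgård Thm 1, implication (2) ⇒ (1), as a
chain). For every squarefree f ∈ ℚ[z,w] and N ∈ ℕ with N = 2·Area(conv(supp f)) such that for all x,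
y > 0 the torus {|z| = x, |w| = y} meets {f = 0} in at most two points, and every representation r
with r.domain = S_f = {p ∈ ℝ²_(>0) : ∃ z w ∈ ℂ, |z| = p₀, |w| = p₁, f(z,w) = 0} and integrand
1/(p₀p₁) on it: 2 • KZ.of r − N • KZ.of ([π]⋆[π]) ∈ KZ.relations (values 2·Area(amoeba) = 2π²Area(Δ)
= N·π², M–R Thm 1; N = 0 forces S_f null or the hypothesis to fail; 'Squarefree' is needed — for f =
g² condition (2) holds and (1) fails). Foreseen chain: modulus chart C⁺ → S_f° (rule 2) · CR
identity · phase chart on period cells (rule 2) landing in π·Δ° · unimodular triangulation + SL₂(ℤ)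
shears · 2·[standard triangle] ~ [π]⋆[π]. [difficulty: XL] -/
@[route_item "route-KontsevichZagierPeriods-AmoebaArea"]
def MaximalAreaLaw : Prop :=
  ∀ (f : MvPolynomial (Fin 2) ℚ) (N : ℕ), Squarefree f → (N : ℝ) = 2 * (MeasureTheory.volume (convexHull ℝ ((fun e : Fin 2 →₀ ℕ => fun i : Fin 2 => ((e i : ℕ) : ℝ)) '' (↑f.support : Set (Fin 2 →₀ ℕ))))).toReal → (∀ x y : ℝ, 0 < x → 0 < y → ({q : ℂ × ℂ | ‖q.1‖ = x ∧ ‖q.2‖ = y ∧ MvPolynomial.aeval ![q.1, q.2] f = 0} : Set (ℂ × ℂ)).encard ≤ 2) → ∀ (r : Literature.NumberTheory.Transcendental.KZ.IntegralRep 2), r.domain = {p : Fin 2 → ℝ | 0 < p 0 ∧ 0 < p 1 ∧ ∃ z w : ℂ, ‖z‖ = p 0 ∧ ‖w‖ = p 1 ∧ MvPolynomial.aeval ![z, w] f = 0} → Set.EqOn r.integrand (fun p => 1 / (p 0 * p 1)) r.domain → 2 • Literature.NumberTheory.Transcendental.KZ.of r - N • Literature.NumberTheory.Transcendental.KZ.of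 (Literature.NumberTheory.Transcendental.KZ.piRep.prod Literature.NumberTheory.Transcendental.KZ.piRep) ∈ Literature.NumberTheory.Transcendental.KZ.relations

/-- item stmt-KontsevichZagierPeriods-8502 · crux · rank 3 · closed · moot by None · by planner
why it might fail: k = 4 is certified (isogeny pullback of the square curve); Harnack-ness for ALL rational k > 4 rests on numerics (5 digits at 4.5, 5, 6) plus dimer theory (2×2-periodic weights): if some k folds, the area drops below 2π² and ¬ follows by soundness. Chain needs two w-sheets glued along a cut.
sources: MikhalkinRullgard2001, KenyonOkounkovSheffield2006, Boyd1998, BoydRodriguezVillegas2002, KontsevichZagier2001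
[crux] THE GENUS-ONE FAMILY (card A2/contrast family; Boyd's tempered family). For every rational k
≥ 4 and every representation r with r.domain = S_k = {p ∈ ℝ²_(>0) : ∃ z w ∈ ℂ, |z| = p₀, |w| = p₁,
z²w + zw² + k·zw + z + w = 0} (i.e. k + z + 1/z + w + 1/w = 0 on the torus; Newton polygon the
diamond, area 2, one interior point) and integrand 1/(p₀p₁): KZ.of r − 2 • KZ.of ([π]⋆[π]) ∈
KZ.relations. Values: Area(amoeba) = 2π² = π²·Area(◇) on the Harnack locus |k| ≥ 4 (numerics in the
planner folder num/diamond_area.py, num/diamond_k4.py: 19.739196 at k = 4 against 2π² = 19.739209;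
19.73923 / 19.73916 / 19.73887 at k = 4.5, 5, 6; continuous drop below: 19.736 at 3.999, 16.38 at 3,
0 at k = 0 where the curve is (z+w)(1+1/zw)); k = 4 is CERTIFIED ALGEBRAICALLY: (1 + z + w − zw)(1 −
z − w − zw) = 1 + z²w² − z² − w² − 4zw, so under the 2-to-1 monomial map (Z,W) = (−zw, z/w) the
union of the square-lattice dimer curve and its sign twist covers {Z + 1/Z + W + 1/W + 4 = 0}, whose
amoeba is therefore the image of the square amoeba under (u,v) ↦ (u+v, u−v) (det 2): area 2·π²
exactly, with a real node at Z = W = −1 (singular Harnack = uniform square lattice with doubled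
fundamental domain); k > -/
@[route_item "route-KontsevichZagierPeriods-AmoebaArea"]
def DiamondHarnack : Prop :=
  ∀ k : ℚ, 4 ≤ k → ∀ (r : Literature.NumberTheory.Transcendental.KZ.IntegralRep 2), r.domain = {p : Fin 2 → ℝ | 0 < p 0 ∧ 0 < p 1 ∧ ∃ z w : ℂ, ‖z‖ = p 0 ∧ ‖w‖ = p 1 ∧ z ^ 2 * w + z * w ^ 2 + (k : ℂ) * z * w + z + w = 0} → Set.EqOn r.integrand (fun p => 1 / (p 0 * p 1)) r.domain → Literature.NumberTheory.Transcendental.KZ.of r - 2 • Literature.NumberTheory.Transcendental.KZ.of (Literature.NumberTheory.Transcendental.KZ.piRep.prod Literature.NumberTheory.Transcendental.KZ.piRep) ∈ Literature.NumberTheory.Transcendental.KZ.relations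

/-- item stmt-KontsevichZagierPeriods-8503 · crux · rank 4 · closed · moot by None · by planner
why it might fail: Values certified (π² on the whole cell); the risk is the UNIFORM chain: the singular fibres x = |a/b|, |c/d| and the phase image (a π×π square cut by period lines into pieces that move with arg-data of a,b,c,d) must be carried semialgebraically in the parameters; false as typed only by a slip.
sources: MikhalkinRullgard2001, ForsbergPassareTsikh2000, KenyonOkounkovSheffield2006, KontsevichZagier2001
[crux] THE UNIT-SQUARE FAMILY = card A2 for Δ = □ in full (Harnack locus = the semialgebraic cell
abcd < 0 of coefficient space). For all rationals a, b, c, d with abcd < 0 and every representation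
r with r.domain = {p ∈ ℝ²_(>0) : ∃ z w ∈ ℂ, |z| = p₀, |w| = p₁, a + bz + cw + dzw = 0} and integrand
1/(p₀p₁): KZ.of r − KZ.of ([π]⋆[π]) ∈ KZ.relations. Values: torus dilation normalises to 1 + z + w +
t·zw, t = ad/(bc) < 0; the Log-fibre over |z| = x is the full interval [||a|−|b|x||/(|c|+|d|x),
(|a|+|b|x)/||c|−|d|x||] (the ratio |a+bz|/|c+dz| is monotone in cos θ exactly when abcd < 0, which
is also the 2-to-1 property), so Area = L(|b/a|) + L(|d/c|) = π² with L(α) = ∫₀^∞ log((1+αx)/|1−αx|)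
dx/x = π²/2 for every α > 0; numerics 9.8704 (t = −1), 9.8702 (t = −1/2), 9.8673 (t = −3,
grid-limited) against π² = 9.8696, and the drop outside the locus: 3.8214 at t = 1/2 and t = 2, 0 at
t = 1 where (1+z)(1+w) is reducible. (a,b,c,d) = (1,1,1,−1) is the square-lattice dimer spectral
curve. [difficulty: M] -/
@[route_item "route-KontsevichZagierPeriods-AmoebaArea"]
def SquareHarnack : Prop :=
  ∀ a b c d : ℚ, a * b * c * d < 0 → ∀ (r : Literature.NumberTheory.Transcendental.KZ.IntegralRep 2), r.domain = {p : Fin 2 → ℝ | 0 < p 0 ∧ 0 < p 1 ∧ ∃ z w : ℂ, ‖z‖ = p 0 ∧ ‖w‖ = p 1 ∧ (a : ℂ) + (b : ℂ) * z + (c : ℂ) * w + (d : ℂ) * z * w = 0} → Set.EqOn r.integrand (fun p => 1 / (p 0 * p 1)) r.domain → Literature.NumberTheory.Transcendental.KZ.of r - Literature.NumberTheory.Transcendental.KZ.of (Literature.NumberTheory.Transcendental.KZ.piRep.prod Literature.NumberTheory.Transcendental.KZ.piRep) ∈ Literature.NumberTheory.Transcendental.KZ.relations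

/-- item stmt-KontsevichZagierPeriods-8504 · support · rank 9 · closed · moot by None · by planner
sources: PassareRullgard2004, ForsbergPassareTsikh2000, KontsevichZagier2001
[support] CALIBRATION (card A1; the law with N = 1). For every representation r with r.domain = {p :
0 < p₀, 0 < p₁, 1 < p₀ + p₁, p₀ < p₁ + 1, p₁ < p₀ + 1} (the open exponentiated amoeba of 1 + z + w:
the triangle inequalities for side lengths 1, x, y) and integrand 1/(p₀p₁): 2 • KZ.of r − KZ.of
([π]⋆[π]) ∈ KZ.relations. Value ∫ dx dy/(xy) = ∫₀^∞ log((1+x)/|1−x|) dx/x = π²/2 (4.9348022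
numerically, 7 digits) — a triangle-inequality representation of 3ζ(2) that is neither a simplex nor
a product. TWO explicit chains of about ten moves each: the Cauchy–Riemann chain LineModulusChart⁻¹
· LinePhaseChart · swap symmetry (p,q) ↦ (q,p) · product [ℝ_(>0), 2/(1+p²)]^×2 ~ [π]⋆[π]; and the
dilogarithm chain: split at x = 1, inversion (x,y) ↦ (1/x, y/x) (rule 2, |J| = x⁻³) onto the half x
< 1, LineShearChart, u = 1 − 2s and 1/(1−xu) + 1/(1+xu) = 2/(1−x²u²) (rules 2, 1a, 1b), then
Calabi's rational-trigonometric change of variables for ∫∫ dxdu/(1−x²u²) = π²/8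
(Beukers–Kolk–Calabi) — the first explicit pair of structurally different chains for one identity
(datum for routes CommonUnfolding / proof-complexity cards). [difficulty: provable-now] -/
@[route_item "route-KontsevichZagierPeriods-AmoebaArea"]
def LineAmoeba : Prop :=
  ∀ (r : Literature.NumberTheory.Transcendental.KZ.IntegralRep 2), r.domain = {p : Fin 2 → ℝ | 0 < p 0 ∧ 0 < p 1 ∧ 1 < p 0 + p 1 ∧ p 0 < p 1 + 1 ∧ p 1 < p 0 + 1} → Set.EqOn r.integrand (fun p => 1 / (p 0 * p 1)) r.domain → 2 • Literature.NumberTheory.Transcendental.KZ.of r - Literature.NumberTheory.Transcendental.KZ.of (Literature.NumberTheory.Transcendental.KZ.piRep.prod Literature.NumberTheory.Transcendental.KZ.piRep) ∈ Literature.NumberTheory.Transcendental.KZ.relations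

/-- item stmt-KontsevichZagierPeriods-8505 · support · rank 9 · closed · moot by None · by planner
sources: MikhalkinRullgard2001, KontsevichZagier2001, BCR1998
[support] (M2, modulus; ONE rule-2 move.) The upper half plane H = {(s,t) : t > 0} ≅ C⁺ = {(z, −1−z)
: Im z > 0} parametrises half the line; Φ(s,t) = (|z|, |1+z|) = (√(s²+t²), √((1+s)²+t²)) is
ℚ-semialgebraic, injective on H, Φ(H) = the open triangle-inequality region, |det Φ′| = t/(xy);
hence for r = [H, t/((s²+t²)((1+s)²+t²))] and r′ = [Φ(H), 1/(xy)]: KZ.of r − KZ.of r′ ∈ KZ.relations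
(one element of changeOfVariablesRel). Values both π²/2 (the s-fibre integral is exactly
2π/(1+4t²)). [difficulty: provable-now] -/
@[route_item "route-KontsevichZagierPeriods-AmoebaArea"]
def LineModulusChart : Prop :=
  ∀ (r r' : Literature.NumberTheory.Transcendental.KZ.IntegralRep 2), r.domain = {q : Fin 2 → ℝ | 0 < q 1} → Set.EqOn r.integrand (fun q => q 1 / ((q 0 ^ 2 + q 1 ^ 2) * ((1 + q 0) ^ 2 + q 1 ^ 2))) r.domain → r'.domain = {p : Fin 2 → ℝ | 0 < p 0 ∧ 0 < p 1 ∧ 1 < p 0 + p 1 ∧ p 0 < p 1 + 1 ∧ p 1 < p 0 + 1} → Set.EqOn r'.integrand (fun p => 1 / (p 0 * p 1)) r'.domain → Literature.NumberTheory.Transcendental.KZ.of r - Literature.NumberTheory.Transcendental.KZ.of r' ∈ Literature.NumberTheory.Transcendental.KZ.relations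

/-- item stmt-KontsevichZagierPeriods-8506 · support · rank 9 · closed · moot by None · by planner
sources: MikhalkinRullgard2001, PassareRullgard2004, KontsevichZagier2001
[support] (M1+M2, phase; ONE rule-2 move with Cauchy–Riemann inside the Jacobian.) Ψ(s,t) = (tan(arg
z/2), tan(arg(1+z)/2)) = (t/(s + √(s²+t²)), t/(1 + s + √((1+s)²+t²))) is ℚ-semialgebraic and
injective on H with image {0 < q < p} (0 < arg(1+z) < arg z < π) and |det Ψ′| = (1+p²)(1+q²)/4 ·
t/(|z|²|1+z|²) — the factor t/(|z|²|1+z|²) = |J_Arg| equals |J_Log|/(xy) pointwise (CR); hence for r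
= [H, t/((s²+t²)((1+s)²+t²))] and r′ = [{0 < q < p}, 4/((1+p²)(1+q²))]: KZ.of r − KZ.of r′ ∈
KZ.relations. Values both π²/2 (∫₀^∞ 4 arctan p dp/(1+p²) = 2(π/2)²); {0 < q < p} is the chart of
the phase polygon π·Δ° of the line. [difficulty: provable-now] -/
@[route_item "route-KontsevichZagierPeriods-AmoebaArea"]
def LinePhaseChart : Prop :=
  ∀ (r r' : Literature.NumberTheory.Transcendental.KZ.IntegralRep 2), r.domain = {q : Fin 2 → ℝ | 0 < q 1} → Set.EqOn r.integrand (fun q => q 1 / ((q 0 ^ 2 + q 1 ^ 2) * ((1 + q 0) ^ 2 + q 1 ^ 2))) r.domain → r'.domain = {p : Fin 2 → ℝ | 0 < p 1 ∧ p 1 < p 0} → Set.EqOn r'.integrand (fun p => 4 / ((1 + p 0 ^ 2) * (1 + p 1 ^ 2))) r'.domain → Literature.NumberTheory.Transcendental.KZ.of r - Literature.NumberTheory.Transcendental.KZ.of r' ∈ Literature.NumberTheory.Transcendental.KZ.relations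

/-- item stmt-KontsevichZagierPeriods-8507 · support · rank 9 · closed · moot by None · by planner
sources: KontsevichZagier2001, PassareRullgard2004
[support] (The competing dilogarithm chain's first move, recorded for the two-chains comparison;
refuter triage note of the card.) On the half x < 1 the Log-fibre is (1−x, 1+x); the shear y = 1 − x
+ 2xs (rule 2, |J| = 2x) gives, for r = [(0,1)², 2/(1 − x + 2xs)] and r′ = [{0 < x < 1, 1−x < y <
1+x}, 1/(xy)]: KZ.of r − KZ.of r′ ∈ KZ.relations. Values both π²/4 (= 2·Σ 1/(2n+1)², Legendre
χ₂(1)·2). [difficulty: provable-now] -/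
@[route_item "route-KontsevichZagierPeriods-AmoebaArea"]
def LineShearChart : Prop :=
  ∀ (r r' : Literature.NumberTheory.Transcendental.KZ.IntegralRep 2), r.domain = {q : Fin 2 → ℝ | 0 < q 0 ∧ q 0 < 1 ∧ 0 < q 1 ∧ q 1 < 1} → Set.EqOn r.integrand (fun q => 2 / (1 - q 0 + 2 * q 0 * q 1)) r.domain → r'.domain = {p : Fin 2 → ℝ | 0 < p 0 ∧ p 0 < 1 ∧ 1 - p 0 < p 1 ∧ p 1 < 1 + p 0} → Set.EqOn r'.integrand (fun p => 1 / (p 0 * p 1)) r'.domain → Literature.NumberTheory.Transcendental.KZ.of r - Literature.NumberTheory.Transcendental.KZ.of r' ∈ Literature.NumberTheory.Transcendental.KZ.relations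

/-- item stmt-KontsevichZagierPeriods-8508 · assembly · rank 1 · closed · moot by None · by planner
sources: KontsevichZagier2001, HuberMullerStach2017
[assembly] MaximalAreaLaw → DiamondHarnack → SquareHarnack → AmoebaKernel → KontsevichZagierPeriods. -/
@[route_item "route-KontsevichZagierPeriods-AmoebaArea"]
def Assembly : Prop :=
  MaximalAreaLaw → DiamondHarnack → SquareHarnack → AmoebaKernel → KontsevichZagierPeriods

end Summit.KontsevichZagierPeriods.KontsevichZagierPeriods.Theses.AmoebaArea
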